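import Summits.HodgeConjecture.CorCM.Model.RosatiThetaProd4
import HarnessLib

/-!
# COR-CM model layer, row M22 input R2 (part B): a Rosati-compatible algebraic polarisation class on the
# corner product `P = A₀ × A₁ × A₂ × A₃` of the Picard–CM model, in Betti dual form

Cell `pub-hodgecm2` (COR-CM = Hodge ladder stage 2), binder row M22 `Fact_algDuality`, input **R2** — "a polarisation
of `P` whose Rosati involution induces complex conjugation on `K`" (Shimura 1998 §6.2 Thm. 4; Milne, CM, Ex. 2.9;
Deligne LNM 900 §4 p. 47), on the MODEL's carriers and for the DIAGONAL action of `K` on `H¹(P; ℚ) = ⊕ᵢ H¹(Aᵢ; ℚ)`,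
seat b26 (part A = one coded realisation, seat b13).  The instance of the generic `rosatiTheta_prod4`
(`CorCM/Model/RosatiThetaProd4`) at the coded realisations `cmRealisation h₃ (c i)`.  HONEST FRAMING: no case of the
Hodge conjecture is proved here.

* `pull_cmRealisation_ι`, `exists_eigenbasis_cmRealisation`, `cmRealisation_dim_pos` — for the coded realisation
  `R = cmRealisation h₃ c` and an abstract field `e : K ≃+* c.E`: the endomorphisms `u(b) = R.ι(e b)`, `b ∈ 𝓞_K`, have
  rational pull-back `u(b)^* = ι(b)` for the model's rational CM action `ι = (BettiUniverse.cmEndAction …).ι` (the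
  `cmAct` field of `Model.universeOf`), and are diagonal on an eigenbasis of `H¹(A(ℂ); ℂ)` indexed by `Hom(c.E, ℂ)`
  (Pohlmann's `exists_eigenbasis`);
* `var_rosatiTheta` — **R2 on the corner product of the model**: for codes `c : Fin 4 → CMCode` and
  `e i : K ≃+* (c i).E` (the package takes `c i := cmCode K (Φ i)`, `e i := cmCodeEquiv K (Φ i)`), with
  `P := Var.prod (Var.prod (Var.prod (.cm (c 0)) (.cm (c 1))) (.cm (c 2))) (.cm (c 3))` (the scheme of `U.prod4 K Φ`),
  there is `θ ∈ H²(P(ℂ); ℚ)` with: `θ ∈ Var.alg P 1`; `θ ⊗ 1` a non-zero real multiple of a Kähler class with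
  `(θ ⊗ 1)^{dim P} ≠ 0`; and the ROSATI IDENTITY IN BETTI DUAL FORM for the diagonal action: for every `a ∈ K` and all
  `ℚ`-linear `T, T'` on `H¹(P(ℂ); ℚ)` with `T ∘ prᵢ^* = prᵢ^* ∘ ιᵢ(a)`, `T' ∘ prᵢ^* = prᵢ^* ∘ ιᵢ(ā)` (the `k = 1`
  clauses of `IsDiagAct a Ma`, `IsDiagAct ā Mb` for `T = Ma^*`, `T' = Mb^*`, in the `PicardCM.Var` spelling of
  `Model.var_deg_diag`), `B_θ(φ ∘ T, ψ) = B_θ(φ, ψ ∘ T')`, `B_θ(φ, ψ) = alternatingMapToDual ℚ _ 2 ![φ, ψ] ω`,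
  `wedgeToCup ω = θ`.

## References
* [Shimura1998] G. Shimura, *Abelian Varieties with Complex Multiplication and Modular Functions* (1998), §6.2
  Thm. 3 and Thm. 4 (3).
* [MilneCM2006] J. S. Milne, *Complex Multiplication* (2006), Ch. I Example 2.9, Prop. 3.17.
* [Deligne1982HodgeCycles] P. Deligne (notes by J. S. Milne), *Hodge cycles on abelian varieties*, LNM 900 (1982),
  §4 p. 47, §5 Prop. 5.1 and p. 39.
-/

noncomputable section

open CategoryTheory MonoidalCategory CartesianMonoidalCategory
open Literature.AlgebraicTopology.SingularHomology
open Literature.AlgebraicGeometry Literature.AlgebraicGeometry.Motives Literature.AlgebraicGeometry.HodgeTheory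
open Literature.AlgebraicGeometry.ComplexMultiplication
open Literature.NumberTheory.Automorphic.PicardCM
open NumberField

namespace Summit.HodgeConjecture.CorCM.Model

/-! ### §1 One coded realisation: the endomorphisms `u(b) = ι(e b)`, their eigenbasis and rational pull-back -/

section Factor

variable {K : Type} [Field K] [NumberField K]

/-- **`u(b)^* = ι(b)` on rational `H¹`** for the endomorphism `u(b) = R.ι(e b)` of the coded realisation
`R = cmRealisation h₃ c` (`e : K ≃+* c.E`, `b ∈ 𝓞_K`) and the model's rational CM action
`ι = (BettiUniverse.cmEndAction (R.θ ∘ e) …).ι` (both sides complexify to `θ(e b)`; the rational lattice is injective).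
[cite: Shimura1998, §6.2 Theorem 3, pp. 41–42] -/
theorem pull_cmRealisation_ι (hHD : exists_isReal_hodgeModel) (hI : hodgePQ_independent_of_hodgeModel)
    (hU : BallQuotientUniformisedDatum) (h₃ : CMAbelianVarietyRealised) (c : CMCode) (e : K ≃+* c.E) (b : 𝓞 K) :
    BettiUniverse.pull ((cmRealisation h₃ c).ι (RingOfIntegers.mapRingEquiv e b)).hom.hom.hom 1 =
      (BettiUniverse.cmEndAction ((cmRealisation h₃ c).θ.comp e.toRingHom)
        ((cmRealisation h₃ c).exists_map_comp e) hHD hI (Var.isSmoothProjective hU h₃ (.cm c))).ι (b : K) := by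
  have hf : (complexBetti.map ((cmRealisation h₃ c).ι (RingOfIntegers.mapRingEquiv e b)).hom.hom.hom 1).hom =
      ((cmRealisation h₃ c).θ.comp e.toRingHom) (b : K) := by
    rw [(cmRealisation h₃ c).map_ι, RingOfIntegers.mapRingEquiv_apply]
    rfl
  refine LinearMap.ext fun v ↦ ofRatClass_injective (Y := ComplexPoints (cmRealisation h₃ c).A) 1 ?_
  rw [BettiUniverse.cmEndAction_ι, ofRatClass_pull, BettiUniverse.ofRatClass_cmAction, ← hf]

omit [NumberField K] in
/-- **An eigenbasis of `H¹` of a coded realisation for the endomorphisms `u(b) = ι(e b)`**, indexed by the complex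
embeddings `σ` of the code's field, with eigencharacters `σ ∘ e : K → ℂ` (the `σ`-eigenlines of record (iii) are
lines; Pohlmann's `exists_eigenbasis` with a primitive element of `c.E/ℚ` as separating element).
[cite: Shimura1998, §6.2 Thm. 4 (3)] -/
theorem exists_eigenbasis_cmRealisation (h₃ : CMAbelianVarietyRealised) (c : CMCode) (e : K ≃+* c.E) :
    ∃ v : Module.Basis (c.E →+* ℂ) ℂ (complexBetti (cmRealisation h₃ c).A 1),
      ∀ (b : 𝓞 K) (σ : c.E →+* ℂ),
        complexBetti.map ((cmRealisation h₃ c).ι (RingOfIntegers.mapRingEquiv e b)).hom.hom.hom 1 (v σ) =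
          ((σ.comp e.toRingHom) (b : K)) • v σ := by
  classical
  have hA : IsCMTypeRealisation c.Φ (cmRealisation h₃ c).AV (cmRealisation h₃ c).ι (cmRealisation h₃ c).θ :=
    ⟨(cmRealisation h₃ c).isSmoothProjective, (cmRealisation h₃ c).finrank_eq, (cmRealisation h₃ c).map_ι,
      fun σ ↦ ⟨(cmRealisation h₃ c).finrank_eigenline σ, (cmRealisation h₃ c).hodgeType_of_mem σ,
        (cmRealisation h₃ c).hodgeType_of_not_mem σ⟩⟩
  obtain ⟨α, hα⟩ := Field.exists_primitive_element ℚ c.E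
  have hinjα : Function.Injective fun φ : c.E →ₐ[ℚ] ℂ ↦ φ α :=
    (Field.primitive_element_iff_algHom_eq_of_eval' ℚ ℂ (fun x ↦ IsAlgClosed.splits _) α).1 hα
  have hinj : Function.Injective fun σ : c.E →+* ℂ ↦ σ α := by
    intro σ σ' hσ
    have h := hinjα (show (fun φ : c.E →ₐ[ℚ] ℂ ↦ φ α) σ.toRatAlgHom =
      (fun φ : c.E →ₐ[ℚ] ℂ ↦ φ α) σ'.toRatAlgHom from hσ)
    rw [← RingHom.toRatAlgHom_toRingHom σ, ← RingHom.toRatAlgHom_toRingHom σ', h]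
  obtain ⟨v, hv⟩ := Pohlmann1968.exists_eigenbasis hA hinj
  refine ⟨v, fun b σ ↦ ?_⟩
  change (complexBetti.map ((cmRealisation h₃ c).ι (RingOfIntegers.mapRingEquiv e b)).hom.hom.hom 1).hom (v σ) = _
  rw [(cmRealisation h₃ c).map_ι, RingOfIntegers.mapRingEquiv_apply]
  exact hv σ (e b)

/-- The coded realisation has positive dimension (`dim H¹ = [E:ℚ] = 2 dim A`, `[E:ℚ] > 0`). [folklore] -/
theorem cmRealisation_dim_pos (h₃ : CMAbelianVarietyRealised) (c : CMCode) : 0 < (cmRealisation h₃ c).AV.dim := by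
  have h1 := abelianVarietyCohomologyExteriorH1_holds.finrank_one (cmRealisation h₃ c).AV
  have h2 : Module.finrank ℂ (complexBetti (cmRealisation h₃ c).AV.X 1) = Module.finrank ℚ c.E :=
    (cmRealisation h₃ c).finrank_eq
  have h3 : 0 < Module.finrank ℚ c.E := Module.finrank_pos
  omega

end Factor

/-! ### §2 R2 on the corner product of the Picard–CM model -/

section Model


/-- **R2 on the corner product `P = A₀ × A₁ × A₂ × A₃` of the Picard–CM model (row M22 input, Betti dual form).**
For CM codes `c : Fin 4 → CMCode` read through an abstract CM field `e i : K ≃+* (c i).E` (package: `c i = cmCode K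
(Φ i)`, `e i = cmCodeEquiv K (Φ i)`), with `P` the left-nested product of the `Var.cm (c i)` (the scheme of
`U.prod4 K Φ`) and `ιᵢ` the model's rational CM action on `H¹(Aᵢ(ℂ); ℚ)` (`cmAct`), there is a class
`θ ∈ H²(P(ℂ); ℚ)` which is RATIONAL-ALGEBRAIC (`Var.alg P 1`), whose complexification is a non-zero real multiple of
a KÄHLER class with NON-ZERO TOP POWER, and whose Rosati involution induces complex conjugation on `K` for the
DIAGONAL action, in Betti dual form: for `a ∈ K` and `ℚ`-linear `T, T'` on `H¹(P(ℂ); ℚ)` with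
`T ∘ prᵢ^* = prᵢ^* ∘ ιᵢ(a)` and `T' ∘ prᵢ^* = prᵢ^* ∘ ιᵢ(ā)` (`i = 0, …, 3`; e.g. `T = Ma^*`, `T' = Mb^*` for
`IsDiagAct a Ma`, `IsDiagAct ā Mb`), `B_θ(φ ∘ T, ψ) = B_θ(φ, ψ ∘ T')` for all covectors `φ, ψ`, where
`B_θ(φ, ψ) = alternatingMapToDual ℚ _ 2 ![φ, ψ] ω`, `wedgeToCup ω = θ`.  (Shimura: "`E(z, T(ξ)w) = E(T(ξ^ρ)z, w)`
for every `ξ ∈ K`"; Deligne: "`ψ(ev, w) = ψ(v, e†w)`".)  Proof: the hyperplane class of `B` averaged over the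
diagonal `𝓞_K`-action (`exists_rosati_ratClass_of_eigenbasis` on `B` with the eigenbasis of `exists_diagData_prod4`),
its `K`-balanced clause descended to `H²(B(ℂ); ℚ)`, then `bettiDual_rosati_of_balanced_endo` and the Künneth
junction `T = ι_B(a)`.
[cite: Shimura1998, §6.2 Theorem 4 (3)] [cite: MilneCM2006, Ch. I Example 2.9 and Prop. 3.17]
[cite: Deligne1982HodgeCycles, §4 p. 47 and §5 p. 39] -/
theorem var_rosatiTheta (hHD : exists_isReal_hodgeModel) (hI : hodgePQ_independent_of_hodgeModel)
    (hU : BallQuotientUniformisedDatum) (h₃ : CMAbelianVarietyRealised)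
    (c : Fin 4 → CMCode) {K : Type} [Field K] [NumberField K] [IsCMField K]
    (e : (i : Fin 4) → (K ≃+* (c i).E)) :
    ∃ θ : bettiCohomology (Var.scheme hU h₃
        (Var.prod (Var.prod (Var.prod (.cm (c 0)) (.cm (c 1))) (.cm (c 2))) (.cm (c 3)))) 2,
      θ ∈ Var.alg hU h₃ (Var.prod (Var.prod (Var.prod (.cm (c 0)) (.cm (c 1))) (.cm (c 2))) (.cm (c 3))) 1 ∧
      (∃ s : ℝ, s ≠ 0 ∧ IsKaehlerClass
          (Var.dim (Var.prod (Var.prod (Var.prod (.cm (c 0)) (.cm (c 1))) (.cm (c 2))) (.cm (c 3))))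
          (Var.scheme hU h₃ (Var.prod (Var.prod (Var.prod (.cm (c 0)) (.cm (c 1))) (.cm (c 2))) (.cm (c 3))))
          ((s : ℂ) • ofRatClass _ 2 θ)) ∧
      cupPowTwo (ofRatClass _ 2 θ)
          (Var.dim (Var.prod (Var.prod (Var.prod (.cm (c 0)) (.cm (c 1))) (.cm (c 2))) (.cm (c 3)))) ≠ 0 ∧
      ∀ ω : ⋀[ℚ]^2 (bettiCohomology (Var.scheme hU h₃
          (Var.prod (Var.prod (Var.prod (.cm (c 0)) (.cm (c 1))) (.cm (c 2))) (.cm (c 3)))) 1),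
        wedgeToCup ℚ _ 2 ω = θ →
        ∀ (a : K) (T T' : bettiCohomology (Var.scheme hU h₃
            (Var.prod (Var.prod (Var.prod (.cm (c 0)) (.cm (c 1))) (.cm (c 2))) (.cm (c 3)))) 1 →ₗ[ℚ]
          bettiCohomology (Var.scheme hU h₃
            (Var.prod (Var.prod (Var.prod (.cm (c 0)) (.cm (c 1))) (.cm (c 2))) (.cm (c 3)))) 1),
        (T ∘ₗ BettiUniverse.pull (Var.comp hU h₃ (Var.fst hU h₃ _ (.cm (c 3)))
            (Var.comp hU h₃ (Var.fst hU h₃ _ (.cm (c 2))) (Var.fst hU h₃ (.cm (c 0)) (.cm (c 1))))) 1 =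
          BettiUniverse.pull (Var.comp hU h₃ (Var.fst hU h₃ _ (.cm (c 3)))
            (Var.comp hU h₃ (Var.fst hU h₃ _ (.cm (c 2))) (Var.fst hU h₃ (.cm (c 0)) (.cm (c 1))))) 1 ∘ₗ
          (BettiUniverse.cmEndAction ((cmRealisation h₃ (c 0)).θ.comp (e 0).toRingHom)
            ((cmRealisation h₃ (c 0)).exists_map_comp (e 0)) hHD hI (Var.isSmoothProjective hU h₃ (.cm (c 0)))).ι a) →
        (T ∘ₗ BettiUniverse.pull (Var.comp hU h₃ (Var.fst hU h₃ _ (.cm (c 3)))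
            (Var.comp hU h₃ (Var.fst hU h₃ _ (.cm (c 2))) (Var.snd hU h₃ (.cm (c 0)) (.cm (c 1))))) 1 =
          BettiUniverse.pull (Var.comp hU h₃ (Var.fst hU h₃ _ (.cm (c 3)))
            (Var.comp hU h₃ (Var.fst hU h₃ _ (.cm (c 2))) (Var.snd hU h₃ (.cm (c 0)) (.cm (c 1))))) 1 ∘ₗ
          (BettiUniverse.cmEndAction ((cmRealisation h₃ (c 1)).θ.comp (e 1).toRingHom)
            ((cmRealisation h₃ (c 1)).exists_map_comp (e 1)) hHD hI (Var.isSmoothProjective hU h₃ (.cm (c 1)))).ι a) →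
        (T ∘ₗ BettiUniverse.pull (Var.comp hU h₃ (Var.fst hU h₃ _ (.cm (c 3))) (Var.snd hU h₃ _ (.cm (c 2)))) 1 =
          BettiUniverse.pull (Var.comp hU h₃ (Var.fst hU h₃ _ (.cm (c 3))) (Var.snd hU h₃ _ (.cm (c 2)))) 1 ∘ₗ
          (BettiUniverse.cmEndAction ((cmRealisation h₃ (c 2)).θ.comp (e 2).toRingHom)
            ((cmRealisation h₃ (c 2)).exists_map_comp (e 2)) hHD hI (Var.isSmoothProjective hU h₃ (.cm (c 2)))).ι a) →
        (T ∘ₗ BettiUniverse.pull (Var.snd hU h₃ _ (.cm (c 3))) 1 =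
          BettiUniverse.pull (Var.snd hU h₃ _ (.cm (c 3))) 1 ∘ₗ
          (BettiUniverse.cmEndAction ((cmRealisation h₃ (c 3)).θ.comp (e 3).toRingHom)
            ((cmRealisation h₃ (c 3)).exists_map_comp (e 3)) hHD hI (Var.isSmoothProjective hU h₃ (.cm (c 3)))).ι a) →
        (T' ∘ₗ BettiUniverse.pull (Var.comp hU h₃ (Var.fst hU h₃ _ (.cm (c 3)))
            (Var.comp hU h₃ (Var.fst hU h₃ _ (.cm (c 2))) (Var.fst hU h₃ (.cm (c 0)) (.cm (c 1))))) 1 =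
          BettiUniverse.pull (Var.comp hU h₃ (Var.fst hU h₃ _ (.cm (c 3)))
            (Var.comp hU h₃ (Var.fst hU h₃ _ (.cm (c 2))) (Var.fst hU h₃ (.cm (c 0)) (.cm (c 1))))) 1 ∘ₗ
          (BettiUniverse.cmEndAction ((cmRealisation h₃ (c 0)).θ.comp (e 0).toRingHom)
            ((cmRealisation h₃ (c 0)).exists_map_comp (e 0)) hHD hI (Var.isSmoothProjective hU h₃ (.cm (c 0)))).ι
            (IsCMField.complexConj K a)) →
        (T' ∘ₗ BettiUniverse.pull (Var.comp hU h₃ (Var.fst hU h₃ _ (.cm (c 3)))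
            (Var.comp hU h₃ (Var.fst hU h₃ _ (.cm (c 2))) (Var.snd hU h₃ (.cm (c 0)) (.cm (c 1))))) 1 =
          BettiUniverse.pull (Var.comp hU h₃ (Var.fst hU h₃ _ (.cm (c 3)))
            (Var.comp hU h₃ (Var.fst hU h₃ _ (.cm (c 2))) (Var.snd hU h₃ (.cm (c 0)) (.cm (c 1))))) 1 ∘ₗ
          (BettiUniverse.cmEndAction ((cmRealisation h₃ (c 1)).θ.comp (e 1).toRingHom)
            ((cmRealisation h₃ (c 1)).exists_map_comp (e 1)) hHD hI (Var.isSmoothProjective hU h₃ (.cm (c 1)))).ι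
            (IsCMField.complexConj K a)) →
        (T' ∘ₗ BettiUniverse.pull (Var.comp hU h₃ (Var.fst hU h₃ _ (.cm (c 3))) (Var.snd hU h₃ _ (.cm (c 2)))) 1 =
          BettiUniverse.pull (Var.comp hU h₃ (Var.fst hU h₃ _ (.cm (c 3))) (Var.snd hU h₃ _ (.cm (c 2)))) 1 ∘ₗ
          (BettiUniverse.cmEndAction ((cmRealisation h₃ (c 2)).θ.comp (e 2).toRingHom)
            ((cmRealisation h₃ (c 2)).exists_map_comp (e 2)) hHD hI (Var.isSmoothProjective hU h₃ (.cm (c 2)))).ι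
            (IsCMField.complexConj K a)) →
        (T' ∘ₗ BettiUniverse.pull (Var.snd hU h₃ _ (.cm (c 3))) 1 =
          BettiUniverse.pull (Var.snd hU h₃ _ (.cm (c 3))) 1 ∘ₗ
          (BettiUniverse.cmEndAction ((cmRealisation h₃ (c 3)).θ.comp (e 3).toRingHom)
            ((cmRealisation h₃ (c 3)).exists_map_comp (e 3)) hHD hI (Var.isSmoothProjective hU h₃ (.cm (c 3)))).ι
            (IsCMField.complexConj K a)) →
        ∀ φ ψ : Module.Dual ℚ (bettiCohomology (Var.scheme hU h₃
            (Var.prod (Var.prod (Var.prod (.cm (c 0)) (.cm (c 1))) (.cm (c 2))) (.cm (c 3)))) 1),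
          exteriorPower.alternatingMapToDual ℚ _ 2 ![φ ∘ₗ T, ψ] ω =
            exteriorPower.alternatingMapToDual ℚ _ 2 ![φ, ψ ∘ₗ T'] ω := by
  obtain ⟨v₀, hv₀⟩ := exists_eigenbasis_cmRealisation h₃ (c 0) (e 0)
  obtain ⟨v₁, hv₁⟩ := exists_eigenbasis_cmRealisation h₃ (c 1) (e 1)
  obtain ⟨v₂, hv₂⟩ := exists_eigenbasis_cmRealisation h₃ (c 2) (e 2)
  obtain ⟨v₃, hv₃⟩ := exists_eigenbasis_cmRealisation h₃ (c 3) (e 3)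
  obtain ⟨θ, hθalg, hK, htop, hros⟩ := rosatiTheta_prod4 (K := K)
    (cmRealisation h₃ (c 0)).AV (cmRealisation h₃ (c 1)).AV (cmRealisation h₃ (c 2)).AV (cmRealisation h₃ (c 3)).AV
    (fun b ↦ (cmRealisation h₃ (c 0)).ι (RingOfIntegers.mapRingEquiv (e 0) b))
    (fun b ↦ (cmRealisation h₃ (c 1)).ι (RingOfIntegers.mapRingEquiv (e 1) b))
    (fun b ↦ (cmRealisation h₃ (c 2)).ι (RingOfIntegers.mapRingEquiv (e 2) b))
    (fun b ↦ (cmRealisation h₃ (c 3)).ι (RingOfIntegers.mapRingEquiv (e 3) b))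
    v₀ v₁ v₂ v₃ (fun σ ↦ σ.comp (e 0).toRingHom) (fun σ ↦ σ.comp (e 1).toRingHom)
    (fun σ ↦ σ.comp (e 2).toRingHom) (fun σ ↦ σ.comp (e 3).toRingHom) hv₀ hv₁ hv₂ hv₃ _ _ _ _
    (pull_cmRealisation_ι hHD hI hU h₃ (c 0) (e 0)) (pull_cmRealisation_ι hHD hI hU h₃ (c 1) (e 1))
    (pull_cmRealisation_ι hHD hI hU h₃ (c 2) (e 2)) (pull_cmRealisation_ι hHD hI hU h₃ (c 3) (e 3))
  -- `dim B = Var.dim P` (both are dimensions of smooth projective witnesses of the same scheme)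
  have hdimP : (((((cmRealisation h₃ (c 0)).AV.prod (cmRealisation h₃ (c 1)).AV).prod
      (cmRealisation h₃ (c 2)).AV).prod (cmRealisation h₃ (c 3)).AV).dim) =
      Var.dim (Var.prod (Var.prod (Var.prod (.cm (c 0)) (.cm (c 1))) (.cm (c 2))) (.cm (c 3))) :=
    dim_unique (AbelianVariety.isSmoothProjective_holds
      (A := (((cmRealisation h₃ (c 0)).AV.prod (cmRealisation h₃ (c 1)).AV).prod
        (cmRealisation h₃ (c 2)).AV).prod (cmRealisation h₃ (c 3)).AV))
      (Var.isSmoothProjective hU h₃ (Var.prod (Var.prod (Var.prod (.cm (c 0)) (.cm (c 1))) (.cm (c 2))) (.cm (c 3))))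
  refine ⟨θ, hθalg, ?_, ?_, fun ω hω a T T' hT₀ hT₁ hT₂ hT₃ hT'₀ hT'₁ hT'₂ hT'₃ φ ψ ↦ ?_⟩
  · rw [← hdimP]
    exact hK
  · rw [← hdimP]
    exact htop
  · exact hros ω hω a T T' hT₀ hT₁ hT₂ hT₃ hT'₀ hT'₁ hT'₂ hT'₃ φ ψ

end Model

end Summit.HodgeConjecture.CorCM.Model

end
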